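import Summits.Ventures.DiscreteObjects.Hadamard.Order225Excluded668

/-!
# Hadamard 668 census, family F12 — NO signed automorphism of an H(668) has pair-order `385 = 5·7·11` or
# `429 = 3·11·13` (kernel, exclusion)

Framing: lottery ticket; floor = certified bounds/negative ranges.

Cell pub-namedobj (venture DiscreteObjects), target (H), hadamard gen 18.  Orbit counting for a cyclic group `⟨π⟩` of
order `pqr` (three distinct odd primes) on the rows, `F_k = #Fix π^k`: the prime censuses give `F_{qr} ∈ W_p`,
`F_{pr} ∈ W_q`, `F_{pq} ∈ W_r` (fixed rows of the elements `g^{qr}, g^{pr}, g^{pq}` of orders `p, q, r`), the chains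
`p ∣ F_p − F₁`, `q ∣ F_q − F₁`, `r ∣ F_r − F₁`, the two-prime identities `F_{pq} + F₁ = F_p + F_q + pq·x` (etc.) and
the three-set inclusion–exclusion `668 + F_p + F_q + F_r = F_{pq} + F_{pr} + F_{qr} + F₁ + pqr·w`
(`card_fixed_incl_excl3`; exact-period-`pqr` rows are `pqr`-divisible in number, `dvd_card_period3`).  For
`(p,q,r) = (5,7,11)` and `(3,11,13)` the integer system is infeasible (`omega`; exact enumeration agrees:
pub-namedobj-hadamard-g18/code/cyclic_orbit_types_g18.py — while `105, 165, 195, 231, 273` have admissible orbit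
types).  **`no_hadamard668_signedAut_order_385`**, **`no_hadamard668_signedAut_order_429`** and the `orderOf` forms.
EXCLUSION of element orders only; H(668) untouched.  Ours; no `sorry`, no definitions.
-/

namespace Summit.Ventures.DiscreteObjects.Hadamard

open Finset BigOperators Matrix

open Literature.Combinatorics.Designs.GoethalsSeidel (IsHadamardMatrix)

variable {ι : Type*} [Fintype ι] [DecidableEq ι]

omit [Fintype ι] [DecidableEq ι] in
/-- divisors of `p·q·r` for primes `p, q, r` -/
lemma dvd_three_primes {p q r d : ℕ} (hp : p.Prime) (hq : q.Prime) (hr : r.Prime) (h : d ∣ p * q * r) :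
    d = 1 ∨ d = p ∨ d = q ∨ d = r ∨ d = p * q ∨ d = p * r ∨ d = q * r ∨ d = p * q * r := by
  obtain ⟨d₁, d₂, h₁, h₂, rfl⟩ := Nat.dvd_mul.1 h
  rcases dvd_prime_mul hp hq h₁ with rfl | rfl | rfl | rfl <;>
    rcases (Nat.dvd_prime hr).1 h₂ with rfl | rfl <;> simp [mul_comm, mul_left_comm]

section counting
variable (π : Equiv.Perm ι)

/-- points of exact period `n` with three 'maximal divisors' `a, b, c` are `n`-divisible in number -/
lemma dvd_card_period3 {n a b c : ℕ} (hn : 0 < n) (hdiv : ∀ d, d ∣ n → d < n → d ∣ a ∨ d ∣ b ∨ d ∣ c) :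
    n ∣ (univ.filter fun y => (π ^ n) y = y ∧ (π ^ a) y ≠ y ∧ (π ^ b) y ≠ y ∧ (π ^ c) y ≠ y).card := by
  refine dvd_card_of_period π hn (fun y => (π ^ n) y = y ∧ (π ^ a) y ≠ y ∧ (π ^ b) y ≠ y ∧ (π ^ c) y ≠ y) ?_
    (fun y hy => hy.1) ?_ _ (fun y => by simp)
  · intro y hy
    refine ⟨by rw [pow_apply_comm π n y, hy.1], fun h => hy.2.1 ?_, fun h => hy.2.2.1 ?_, fun h => hy.2.2.2 ?_⟩
    · rw [pow_apply_comm π a y] at h; exact π.injective h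
    · rw [pow_apply_comm π b y] at h; exact π.injective h
    · rw [pow_apply_comm π c y] at h; exact π.injective h
  · intro y hy d hd hdlt hfix
    rcases hdiv d hd hdlt with h | h | h
    · exact hy.2.1 (fixed_pow_of_dvd π hfix h)
    · exact hy.2.2.1 (fixed_pow_of_dvd π hfix h)
    · exact hy.2.2.2 (fixed_pow_of_dvd π hfix h)

/-- **three-set inclusion–exclusion of fixed sets** for `n = p·q·r`:
`#Fix π^n + #Fix π^p + #Fix π^q + #Fix π^r = #Fix π^(pq) + #Fix π^(pr) + #Fix π^(qr) + #Fix π + #(exact part)`. -/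
lemma card_fixed_incl_excl3 {p q r : ℕ} (hp : p.Prime) (hq : q.Prime) (hr : r.Prime)
    (hpq : p ≠ q) (hpr : p ≠ r) (hqr : q ≠ r) :
    (univ.filter fun y => (π ^ (p * q * r)) y = y).card + (univ.filter fun y => (π ^ p) y = y).card +
        (univ.filter fun y => (π ^ q) y = y).card + (univ.filter fun y => (π ^ r) y = y).card =
      (univ.filter fun y => (π ^ (p * q)) y = y).card + (univ.filter fun y => (π ^ (p * r)) y = y).card +
        (univ.filter fun y => (π ^ (q * r)) y = y).card + (univ.filter fun y => π y = y).card +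
        (univ.filter fun y => (π ^ (p * q * r)) y = y ∧ (π ^ (p * q)) y ≠ y ∧ (π ^ (p * r)) y ≠ y ∧
          (π ^ (q * r)) y ≠ y).card := by
  set A := univ.filter fun y => (π ^ (p * q)) y = y with hA
  set B := univ.filter fun y => (π ^ (p * r)) y = y with hB
  set C := univ.filter fun y => (π ^ (q * r)) y = y with hC
  -- Fix π^n = (A ∪ B ∪ C) ⊔ exact
  have h1 := Finset.card_filter_add_card_filter_not (s := univ.filter fun y => (π ^ (p * q * r)) y = y)
    (fun y => (π ^ (p * q)) y = y ∨ (π ^ (p * r)) y = y ∨ (π ^ (q * r)) y = y)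
  rw [Finset.filter_filter, Finset.filter_filter] at h1
  have e1 : (univ.filter fun y => (π ^ (p * q * r)) y = y ∧
      ((π ^ (p * q)) y = y ∨ (π ^ (p * r)) y = y ∨ (π ^ (q * r)) y = y)) = A ∪ B ∪ C := by
    ext y
    simp only [Finset.mem_filter, Finset.mem_univ, true_and, Finset.mem_union, hA, hB, hC]
    constructor
    · intro h; rcases h.2 with h | h | h
      · exact Or.inl (Or.inl h)
      · exact Or.inl (Or.inr h)
      · exact Or.inr h
    · intro h
      rcases h with (h | h) | h
      · exact ⟨fixed_pow_of_dvd π h ⟨r, by ring⟩, Or.inl h⟩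
      · exact ⟨fixed_pow_of_dvd π h ⟨q, by ring⟩, Or.inr (Or.inl h)⟩
      · exact ⟨fixed_pow_of_dvd π h ⟨p, by ring⟩, Or.inr (Or.inr h)⟩
  have e2 : (univ.filter fun y => (π ^ (p * q * r)) y = y ∧
      ¬ ((π ^ (p * q)) y = y ∨ (π ^ (p * r)) y = y ∨ (π ^ (q * r)) y = y)) =
      univ.filter fun y => (π ^ (p * q * r)) y = y ∧ (π ^ (p * q)) y ≠ y ∧ (π ^ (p * r)) y ≠ y ∧
        (π ^ (q * r)) y ≠ y := by
    ext y; simp only [Finset.mem_filter, Finset.mem_univ, true_and, not_or, ne_eq]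
  rw [e1, e2] at h1
  -- |A ∪ B ∪ C| + |(A ∪ B) ∩ C| = |A ∪ B| + |C| ; |A ∪ B| + |A ∩ B| = |A| + |B|
  have h2 := Finset.card_union_add_card_inter (A ∪ B) C
  have h3 := Finset.card_union_add_card_inter A B
  -- A ∩ B = Fix π^p, (A ∪ B) ∩ C = Fix π^q ∪ Fix π^r, Fix π^q ∩ Fix π^r = Fix π
  have hgAB : Nat.gcd (p * q) (p * r) = p := by
    rw [Nat.gcd_mul_left, Nat.Coprime.gcd_eq_one ((Nat.coprime_primes hq hr).2 hqr), mul_one]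
  have hgAC : Nat.gcd (p * q) (q * r) = q := by
    rw [mul_comm p q, Nat.gcd_mul_left, Nat.Coprime.gcd_eq_one ((Nat.coprime_primes hp hr).2 hpr), mul_one]
  have hgBC : Nat.gcd (p * r) (q * r) = r := by
    rw [mul_comm p r, mul_comm q r, Nat.gcd_mul_left, Nat.Coprime.gcd_eq_one ((Nat.coprime_primes hp hq).2 hpq),
      mul_one]
  have iAB : A ∩ B = univ.filter fun y => (π ^ p) y = y := by
    ext y
    simp only [hA, hB, Finset.mem_inter, Finset.mem_filter, Finset.mem_univ, true_and]
    constructor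
    · intro h; have := fixed_pow_gcd π h.1 h.2; rwa [hgAB] at this
    · intro h; exact ⟨fixed_pow_of_dvd π h (dvd_mul_right p q), fixed_pow_of_dvd π h (dvd_mul_right p r)⟩
  have iABC : (A ∪ B) ∩ C = (univ.filter fun y => (π ^ q) y = y) ∪ (univ.filter fun y => (π ^ r) y = y) := by
    ext y
    simp only [hA, hB, hC, Finset.mem_inter, Finset.mem_union, Finset.mem_filter, Finset.mem_univ, true_and]
    constructor
    · rintro ⟨h | h, hc⟩
      · left; have := fixed_pow_gcd π h hc; rwa [hgAC] at this
      · right; have := fixed_pow_gcd π h hc; rwa [hgBC] at this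
    · rintro (h | h)
      · exact ⟨Or.inl (fixed_pow_of_dvd π h (dvd_mul_left q p)), fixed_pow_of_dvd π h (dvd_mul_right q r)⟩
      · exact ⟨Or.inr (fixed_pow_of_dvd π h (dvd_mul_left r p)), fixed_pow_of_dvd π h (dvd_mul_left r q)⟩
  have h4 := Finset.card_union_add_card_inter (univ.filter fun y => (π ^ q) y = y)
    (univ.filter fun y => (π ^ r) y = y)
  have iqr : (univ.filter fun y => (π ^ q) y = y) ∩ (univ.filter fun y => (π ^ r) y = y) =
      univ.filter fun y => π y = y := by
    ext y
    simp only [Finset.mem_inter, Finset.mem_filter, Finset.mem_univ, true_and]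
    constructor
    · intro h; exact fixed_of_fixed_pow_two_primes π hq hr hqr h.1 h.2
    · intro h; exact ⟨perm_pow_apply_of_fixed π h q, perm_pow_apply_of_fixed π h r⟩
  rw [iAB] at h3
  rw [iABC] at h2
  rw [iqr] at h4
  omega

end counting

section main
variable {H : Matrix ι ι ℤ}

/-- the integer core for three primes: returns the scalar identities for the rows -/
lemma three_primes_scalar {π : Equiv.Perm ι} (hι : Fintype.card ι = 668)
    {p q r : ℕ} (hp : p.Prime) (hq : q.Prime) (hr : r.Prime) (hpq : p ≠ q) (hpr : p ≠ r) (hqr : q ≠ r)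
    (hπ : π ^ (p * q * r) = 1) :
    ∃ (F1 Fp Fq Fr Fpq Fpr Fqr a b c x y z w : ℕ),
      Fp = (univ.filter fun i => (π ^ p) i = i).card ∧ Fq = (univ.filter fun i => (π ^ q) i = i).card ∧
      Fr = (univ.filter fun i => (π ^ r) i = i).card ∧
      Fpq = (univ.filter fun i => (π ^ (p * q)) i = i).card ∧ Fpr = (univ.filter fun i => (π ^ (p * r)) i = i).card ∧
      Fqr = (univ.filter fun i => (π ^ (q * r)) i = i).card ∧
      Fp = F1 + p * a ∧ Fq = F1 + q * b ∧ Fr = F1 + r * c ∧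
      Fpq + F1 = Fp + Fq + p * q * x ∧ Fpr + F1 = Fp + Fr + p * r * y ∧ Fqr + F1 = Fq + Fr + q * r * z ∧
      668 + Fp + Fq + Fr = Fpq + Fpr + Fqr + F1 + p * q * r * w := by
  have hcp := dvd_card_fixed_pow_sdiff π hp
  have hcq := dvd_card_fixed_pow_sdiff π hq
  have hcr := dvd_card_fixed_pow_sdiff π hr
  have hsp := card_split_by_fixed π (fun i => (π ^ p) i = i) (fun i h => perm_pow_apply_of_fixed π h p)
  have hsq := card_split_by_fixed π (fun i => (π ^ q) i = i) (fun i h => perm_pow_apply_of_fixed π h q)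
  have hsr := card_split_by_fixed π (fun i => (π ^ r) i = i) (fun i h => perm_pow_apply_of_fixed π h r)
  have hcpq := dvd_card_fixed_two_primes_sdiff π hp hq hpq
  have hcpr := dvd_card_fixed_two_primes_sdiff π hp hr hpr
  have hcqr := dvd_card_fixed_two_primes_sdiff π hq hr hqr
  have hspq := card_fixed_incl_excl π (n := p * q) (a := p) (b := q) (dvd_mul_right p q) (dvd_mul_left q p)
  have hspr := card_fixed_incl_excl π (n := p * r) (a := p) (b := r) (dvd_mul_right p r) (dvd_mul_left r p)
  have hsqr := card_fixed_incl_excl π (n := q * r) (a := q) (b := r) (dvd_mul_right q r) (dvd_mul_left r q)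
  rw [Nat.Coprime.gcd_eq_one ((Nat.coprime_primes hp hq).2 hpq), pow_one] at hspq
  rw [Nat.Coprime.gcd_eq_one ((Nat.coprime_primes hp hr).2 hpr), pow_one] at hspr
  rw [Nat.Coprime.gcd_eq_one ((Nat.coprime_primes hq hr).2 hqr), pow_one] at hsqr
  have hcn := dvd_card_period3 π (n := p * q * r) (a := p * q) (b := p * r) (c := q * r)
    (Nat.mul_pos (Nat.mul_pos hp.pos hq.pos) hr.pos)
    (fun dd hd hlt => by
      rcases dvd_three_primes hp hq hr hd with h | h | h | h | h | h | h | h <;> rw [h] <;> rw [h] at hlt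
      · left; exact one_dvd _
      · left; exact dvd_mul_right p q
      · left; exact dvd_mul_left q p
      · right; left; exact dvd_mul_left r p
      · left; exact dvd_rfl
      · right; left; exact dvd_rfl
      · right; right; exact dvd_rfl
      · omega)
  have hs3 := card_fixed_incl_excl3 π hp hq hr hpq hpr hqr
  have htop : (univ.filter fun y => (π ^ (p * q * r)) y = y).card = 668 := by
    rw [← hι, ← Finset.card_univ]; congr 1; ext y; simp [hπ]
  rw [htop] at hs3
  obtain ⟨a, ha⟩ := hcp
  obtain ⟨b, hb⟩ := hcq
  obtain ⟨c, hc⟩ := hcr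
  obtain ⟨x, hx⟩ := hcpq
  obtain ⟨y, hy⟩ := hcpr
  obtain ⟨z, hz⟩ := hcqr
  obtain ⟨w, hw⟩ := hcn
  refine ⟨(univ.filter fun i => π i = i).card, _, _, _, _, _, _, a, b, c, x, y, z, w,
    rfl, rfl, rfl, rfl, rfl, rfl, ?_, ?_, ?_, ?_, ?_, ?_, ?_⟩
  · rw [← ha]; exact hsp
  · rw [← hb]; exact hsq
  · rw [← hc]; exact hsr
  · rw [← hx]; exact hspq
  · rw [← hy]; exact hspr
  · rw [← hz]; exact hsqr
  · rw [← hw]; exact hs3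

/-- **No signed automorphism of pair-order `385 = 5·7·11`.** -/
theorem no_hadamard668_signedAut_order_385 (hH : IsHadamardMatrix H) (hι : Fintype.card ι = 668)
    (π κ : Equiv.Perm ι) (d e : ι → ℤ) (haut : IsSignedAut H π κ d e)
    (hπ : π ^ 385 = 1) (hκ : κ ^ 385 = 1)
    (h77 : π ^ 77 ≠ 1 ∨ κ ^ 77 ≠ 1) (h55 : π ^ 55 ≠ 1 ∨ κ ^ 55 ≠ 1) (h35 : π ^ 35 ≠ 1 ∨ κ ^ 35 ≠ 1) :
    False := by
  have hcard : (Fintype.card ι : ℤ) ≠ 0 := by rw [hι]; norm_num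
  -- censuses: g^77 has order 5, g^55 order 7, g^35 order 11
  have h5 := isSignedAut_pow haut 77
  have h7 := isSignedAut_pow haut 55
  have h11 := isSignedAut_pow haut 35
  have e5 : (π ^ 77) ^ 5 = 1 := by rw [← pow_mul]; exact hπ
  have e5' : (κ ^ 77) ^ 5 = 1 := by rw [← pow_mul]; exact hκ
  have e7 : (π ^ 55) ^ 7 = 1 := by rw [← pow_mul]; exact hπ
  have e7' : (κ ^ 55) ^ 7 = 1 := by rw [← pow_mul]; exact hκ
  have e11 : (π ^ 35) ^ 11 = 1 := by rw [← pow_mul]; exact hπ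
  have e11' : (κ ^ 35) ^ 11 = 1 := by rw [← pow_mul]; exact hκ
  have ne5 : π ^ 77 ≠ 1 := fst_pow_ne_one hH hcard haut (by decide : Odd 5) e5' h77
  have ne7 : π ^ 55 ≠ 1 := fst_pow_ne_one hH hcard haut (by decide : Odd 7) e7' h55
  have ne11 : π ^ 35 ≠ 1 := fst_pow_ne_one hH hcard haut (by decide : Odd 11) e11' h35
  obtain ⟨-, w5a, w5b, w5c⟩ := census5 hH hι h5 e5 e5' ne5
  obtain ⟨-, w7⟩ := census7 hH hι h7 e7 e7' ne7
  obtain ⟨-, w11⟩ := census11 hH hι h11 e11 e11' ne11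
  -- orbit counting
  have hπ' : π ^ (5 * 7 * 11) = 1 := by norm_num; exact hπ
  obtain ⟨F1, Fp, Fq, Fr, Fpq, Fpr, Fqr, a, b, c, x, y, z, w, hFp, hFq, hFr, hFpq, hFpr, hFqr,
    e1, e2, e3, e4, e5x, e6, e7x⟩ :=
    three_primes_scalar hι (by norm_num : (5 : ℕ).Prime) (by norm_num : (7 : ℕ).Prime)
      (by norm_num : (11 : ℕ).Prime) (by norm_num) (by norm_num) (by norm_num) hπ'
  norm_num at hFpq hFpr hFqr
  rw [← hFqr] at w5a w5b w5c
  rw [← hFpr] at w7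
  rw [← hFpq] at w11
  clear hFp hFq hFr hFpq hFpr hFqr h5 h7 h11 e5 e5' e7 e7' e11 e11' ne5 ne7 ne11 hπ hκ hπ' h77 h55 h35 haut hcard hH
  rcases w7 with h | h | h | h | h <;> rcases w11 with h' | h' | h' <;> omega

/-- **No signed automorphism of pair-order `429 = 3·11·13`.** -/
theorem no_hadamard668_signedAut_order_429 (hH : IsHadamardMatrix H) (hι : Fintype.card ι = 668)
    (π κ : Equiv.Perm ι) (d e : ι → ℤ) (haut : IsSignedAut H π κ d e)
    (hπ : π ^ 429 = 1) (hκ : κ ^ 429 = 1)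
    (h143 : π ^ 143 ≠ 1 ∨ κ ^ 143 ≠ 1) (h39 : π ^ 39 ≠ 1 ∨ κ ^ 39 ≠ 1) (h33 : π ^ 33 ≠ 1 ∨ κ ^ 33 ≠ 1) :
    False := by
  have hcard : (Fintype.card ι : ℤ) ≠ 0 := by rw [hι]; norm_num
  have h3 := isSignedAut_pow haut 143
  have h11 := isSignedAut_pow haut 39
  have h13 := isSignedAut_pow haut 33
  have e3 : (π ^ 143) ^ 3 = 1 := by rw [← pow_mul]; exact hπ
  have e3' : (κ ^ 143) ^ 3 = 1 := by rw [← pow_mul]; exact hκ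
  have e11 : (π ^ 39) ^ 11 = 1 := by rw [← pow_mul]; exact hπ
  have e11' : (κ ^ 39) ^ 11 = 1 := by rw [← pow_mul]; exact hκ
  have e13 : (π ^ 33) ^ 13 = 1 := by rw [← pow_mul]; exact hπ
  have e13' : (κ ^ 33) ^ 13 = 1 := by rw [← pow_mul]; exact hκ
  have ne3 : π ^ 143 ≠ 1 := fst_pow_ne_one hH hcard haut (by decide : Odd 3) e3' h143
  have ne11 : π ^ 39 ≠ 1 := fst_pow_ne_one hH hcard haut (by decide : Odd 11) e11' h39
  have ne13 : π ^ 33 ≠ 1 := fst_pow_ne_one hH hcard haut (by decide : Odd 13) e13' h33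
  obtain ⟨-, w3a, w3b, w3c⟩ := census3 hH hι h3 e3 e3' ne3
  obtain ⟨-, w11⟩ := census11 hH hι h11 e11 e11' ne11
  obtain ⟨-, w13⟩ := hadamard668_signedAut_fixedRows hH hι 13 (by norm_num) (by norm_num) (π ^ 33) (κ ^ 33) _ _
    h13 e13 e13' (Or.inl ne13)
  have w13' : (univ.filter fun i => (π ^ 33) i = i).card = 44 := by
    rcases w13 with ⟨-, h⟩ | ⟨h, -⟩ | ⟨h, -⟩ | ⟨h, -⟩ | ⟨h, -⟩ | ⟨h, -⟩ <;> first | exact h | norm_num at h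
  have hπ' : π ^ (3 * 11 * 13) = 1 := by norm_num; exact hπ
  obtain ⟨F1, Fp, Fq, Fr, Fpq, Fpr, Fqr, a, b, c, x, y, z, w, hFp, hFq, hFr, hFpq, hFpr, hFqr,
    e1, e2, e3x, e4, e5, e6, e7⟩ :=
    three_primes_scalar hι (by norm_num : (3 : ℕ).Prime) (by norm_num : (11 : ℕ).Prime)
      (by norm_num : (13 : ℕ).Prime) (by norm_num) (by norm_num) (by norm_num) hπ'
  norm_num at hFpq hFpr hFqr
  rw [← hFqr] at w3a w3b w3c
  rw [← hFpr] at w11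
  rw [← hFpq] at w13'
  clear hFp hFq hFr hFpq hFpr hFqr h3 h11 h13 e3 e3' e11 e11' e13 e13' ne3 ne11 ne13 hπ hκ hπ' h143 h39 h33 haut
    hcard hH w13
  -- staged: the number of regular orbits and of exact-143 orbits are ≤ 1
  have hw : w ≤ 1 := by omega
  have hz : z ≤ 1 := by omega
  interval_cases w <;> interval_cases z <;> rcases w11 with h' | h' | h' <;> omega

/-- **`385 ∤ orderOf (π, κ)`** for every signed automorphism of an H(668). -/
theorem hadamard668_signedAut_not_dvd_orderOf_385 (hH : IsHadamardMatrix H) (hι : Fintype.card ι = 668)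
    (π κ : Equiv.Perm ι) (d e : ι → ℤ) (haut : IsSignedAut H π κ d e)
    (hdvd : 385 ∣ orderOf ((π, κ) : Equiv.Perm ι × Equiv.Perm ι)) : False := by
  set x : Equiv.Perm ι × Equiv.Perm ι := (π, κ) with hx
  have hx0 : orderOf x ≠ 0 := (orderOf_pos x).ne'
  set k := orderOf x / 385 with hk
  have hord : orderOf (x ^ k) = 385 := orderOf_pow_orderOf_div hx0 hdvd
  have hxk : x ^ k = ((π ^ k, κ ^ k) : Equiv.Perm ι × Equiv.Perm ι) := by rw [hx, Prod.pow_mk]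
  rw [hxk] at hord
  obtain ⟨h1, h2, h3⟩ := pow_data_of_orderOf hord (a := 77) (by norm_num) (by norm_num)
  obtain ⟨-, -, h4⟩ := pow_data_of_orderOf hord (a := 55) (by norm_num) (by norm_num)
  obtain ⟨-, -, h5⟩ := pow_data_of_orderOf hord (a := 35) (by norm_num) (by norm_num)
  exact no_hadamard668_signedAut_order_385 hH hι (π ^ k) (κ ^ k) _ _ (isSignedAut_pow haut k) h1 h2 h3 h4 h5

/-- **`429 ∤ orderOf (π, κ)`** for every signed automorphism of an H(668). -/
theorem hadamard668_signedAut_not_dvd_orderOf_429 (hH : IsHadamardMatrix H) (hι : Fintype.card ι = 668)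
    (π κ : Equiv.Perm ι) (d e : ι → ℤ) (haut : IsSignedAut H π κ d e)
    (hdvd : 429 ∣ orderOf ((π, κ) : Equiv.Perm ι × Equiv.Perm ι)) : False := by
  set x : Equiv.Perm ι × Equiv.Perm ι := (π, κ) with hx
  have hx0 : orderOf x ≠ 0 := (orderOf_pos x).ne'
  set k := orderOf x / 429 with hk
  have hord : orderOf (x ^ k) = 429 := orderOf_pow_orderOf_div hx0 hdvd
  have hxk : x ^ k = ((π ^ k, κ ^ k) : Equiv.Perm ι × Equiv.Perm ι) := by rw [hx, Prod.pow_mk]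
  rw [hxk] at hord
  obtain ⟨h1, h2, h3⟩ := pow_data_of_orderOf hord (a := 143) (by norm_num) (by norm_num)
  obtain ⟨-, -, h4⟩ := pow_data_of_orderOf hord (a := 39) (by norm_num) (by norm_num)
  obtain ⟨-, -, h5⟩ := pow_data_of_orderOf hord (a := 33) (by norm_num) (by norm_num)
  exact no_hadamard668_signedAut_order_429 hH hι (π ^ k) (κ ^ k) _ _ (isSignedAut_pow haut k) h1 h2 h3 h4 h5

end main

end Summit.Ventures.DiscreteObjects.Hadamard
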